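import Mathlib
import HarnessLib
import Summits.HubbardSuperconductivity.HubbardSuperconductivity.Theorems.KLProgrammeKLRegimeTwoVolumeFrameMismatchResponseDoor

/-!
# K3 legs at scale `n ≥ 1` (rows C1/C2 of stub (e), stmt-…-20437; VL (A3) scale-`n` step, stmt-…-20440): the FRAME-MISMATCH RESPONSE COMPOSED —
# the shell-count entry sum of the single-scale defect `d` and `‖Σ[T(K₂)] − Σ[T(K₁)] − D(p_k⃗)‖ ≤ 24|β|L²·(Σ_ks‖d‖)·N` at a reading point below both shells

Cell gate-hubbard-kl, seat hubbard-kl-k3c4-p2 (g8).  Sequel of `…TwoVolumeFrameMismatchResum` (p549694: `T(K₂) = chain_D + S_m·effAction (normalCovariance Ψ̃) (V_U + 𝒩_{K₁})`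
exactly, `d = Ψ̃ − Ψ_{K₁}` single-scale with `‖d‖ ≤ βL²(200+200B₁)/Λ²·|D|` under `|D| ≤ Λ/4`) and of `…TwoVolumeFrameMismatchResponseDoor` (the covariance-response
door for the vertex `V_U + 𝒩_K`):
* §1 **`sum_norm_mismatchDefect_le_shell`**: `Σ_ks‖d(ks)‖ ≤ 2·N_ω·(N₁ + N₂)·βL²(200+200B₁)/Λ²·t` for `|D| ≤ t ≤ Λ/4`, `N_ω ≥ #{i : |ω_i| < Λ}`, LEVEL COUNTS
  `N_j ≥ #{k⃗ : |e_{K_j}(k⃗)| < Λ}` (k3c4-p1's `card_frameLevel_lt_le`: `≤ 1793ΛL² + 704L` for admissible frames) — `d` lives on the scale-`Λ` shell of one of the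
  two frames; with `N_ω ≤ Λβ/π + 3` and the door's `N ~ ‖W₄‖/(βL²)³` the response below is `O((1+B₁)·c₁·‖W₄‖₁·t)` — k3c5-p2's «O(U)·F_n», no `1/Λ_n`, no `n`-fold sum;
* §2 **`norm_klSelfEnergy_frame_sub_sub_mismatch_le`** — at a reading point below BOTH shells:
  `‖klSelfEnergy … K₂ e₀ n k σ − klSelfEnergy … K₁ e₀ n k σ − D(p_k⃗)‖ ≤ 2|β|L²·12·(Σ_ks‖d(ks)‖)·N` (the `S`-term drops: `d(k,σ) = 0` there).  Left to the consumer: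
  `Z_t ≠ 0` and the four-leg sup `N` of `𝒲′[Ψ_{K₁} + t·d]`, `t ∈ [0,1]` — a near-identity deformation of `T(K₁)` ((b)'s `KernelNormsV4 … K₁ n` / the (A3) profile).
Proofs only; no definitions; nothing about `N`, `S`, `B₁`, the counts or the sizes of `T` is asserted; nothing asserts superconductivity.
References: Salmhofer 1998 §3.1 Prop. 1; Feldman–Salmhofer–Trubowitz 1996 §1; Benfatto–Giuliani–Mastropietro 2006 §2.3 (2.21)–(2.24).
-/

noncomputable section

namespace Summit.HubbardSuperconductivity.HubbardSuperconductivity.Theorems.TwoVolumeDefect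

set_option linter.dupNamespace false -- summit = problem name (single-conjunct summit), D-0017

open Finset Complex Literature.MathematicalPhysics.QuantumLattice Literature.Probability.LatticeModels GrassmannAlgebra
open Summit.HubbardSuperconductivity.HubbardSuperconductivity.Theorems.KLRegimeSplit
open Summit.HubbardSuperconductivity.HubbardSuperconductivity.Theorems.KLProgrammeLegKernels
open Summit.HubbardSuperconductivity.HubbardSuperconductivity.Theorems.EngineV8
open Summit.HubbardSuperconductivity.HubbardSuperconductivity.Theorems.TwoPointAssembly

variable {L M : ℕ} [NeZero L]

/-! ## §1 The SHELL-COUNT entry sum of the single-scale defect `d = Ψ̃ − Ψ_{K₁}` -/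

section Shell

variable {β : ℝ} (hβ : 0 < β) (μ : ℝ) (K₁ K₂ : TrigPolyC4v) (Λ : ℝ)
include hβ

/-- **Shell-count entry sum of the defect**: if `|D(p_k⃗)| ≤ t ≤ Λ/4` everywhere, `N_ω ≥ #{i : |ω_i| < Λ}` and `N_j ≥ #{k⃗ : |e_{K_j}(k⃗)| < Λ}`, then
`Σ_ks ‖Ψ̃(ks) − Ψ_{K₁}(ks)‖ ≤ 2·N_ω·(N₁ + N₂)·βL²(200+200B₁)/Λ²·t` (`d(ks) = 0` unless `ω_i² + e_{K_j}² < Λ²` for some `j`, which forces `|ω_i| < Λ` and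
`|e_{K_j}| < Λ`; `2` = spin). [cite: BenfattoGiulianiMastropietro2006, §2.2 (2.27)–(2.28)] -/
theorem sum_norm_mismatchDefect_le_shell {B₁ : ℝ} (hB0 : 0 ≤ B₁) (hB : ∀ y, |deriv salmhoferCutoff y| ≤ B₁) (hΛ : 0 < Λ)
    {t : ℝ} (ht : t ≤ Λ / 4) (hD : ∀ kv : TorusSite 2 L, |(fsub K₂ K₁).eval (latticeMomentum L kv)| ≤ t)
    {Nω N₁ N₂ : ℕ} (hNω : (Finset.univ.filter fun i : MatsubaraIdx M => |matsubaraFreq β M i| < Λ).card ≤ Nω)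
    (hN₁ : (Finset.univ.filter fun kv : TorusSite 2 L => |nambuXiCT L μ K₁ kv| < Λ).card ≤ N₁)
    (hN₂ : (Finset.univ.filter fun kv : TorusSite 2 L => |nambuXiCT L μ K₂ kv| < Λ).card ≤ N₂) :
    ∑ ks : FreqMomentum L M × Fin 2,
        ‖uvSymbolCT L M β μ K₂ Λ ks /
              (1 + uvSymbolCT L M β μ K₂ Λ ks * (((fsub K₂ K₁).eval (latticeMomentum L ks.1.2) / (β * (L : ℝ) ^ 2) : ℝ) : ℂ)) -
            uvSymbolCT L M β μ K₁ Λ ks‖ ≤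
      2 * (Nω : ℝ) * ((N₁ : ℝ) + N₂) * (β * (L : ℝ) ^ 2 * (200 + 200 * B₁) / Λ ^ 2 * t) := by
  classical
  have hL : (0 : ℝ) < L := by exact_mod_cast NeZero.pos L
  have ht0 : 0 ≤ t := (abs_nonneg _).trans (hD 0)
  set c : ℝ := β * (L : ℝ) ^ 2 * (200 + 200 * B₁) / Λ ^ 2 * t with hcdef
  have hc : 0 ≤ c := by positivity
  -- the support set: frequency window × (level set of `K₁` ∪ level set of `K₂`) × spins
  set Sω := Finset.univ.filter fun i : MatsubaraIdx M => |matsubaraFreq β M i| < Λ with hSω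
  set S₁ := Finset.univ.filter fun kv : TorusSite 2 L => |nambuXiCT L μ K₁ kv| < Λ with hS₁
  set S₂ := Finset.univ.filter fun kv : TorusSite 2 L => |nambuXiCT L μ K₂ kv| < Λ with hS₂
  set Supp : Finset (FreqMomentum L M × Fin 2) := (Sω ×ˢ (S₁ ∪ S₂)) ×ˢ (Finset.univ : Finset (Fin 2)) with hSupp
  -- off the support the defect vanishes
  have hzero : ∀ ks : FreqMomentum L M × Fin 2, ks ∉ Supp →
      uvSymbolCT L M β μ K₂ Λ ks /
            (1 + uvSymbolCT L M β μ K₂ Λ ks * (((fsub K₂ K₁).eval (latticeMomentum L ks.1.2) / (β * (L : ℝ) ^ 2) : ℝ) : ℂ)) -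
          uvSymbolCT L M β μ K₁ Λ ks = 0 := by
    rintro ⟨⟨i, kv⟩, σ⟩ hks
    have hks' : (|matsubaraFreq β M i| < Λ → Λ ≤ |nambuXiCT L μ K₁ kv|) ∧ (|matsubaraFreq β M i| < Λ → Λ ≤ |nambuXiCT L μ K₂ kv|) := by
      simpa [hSupp, hSω, hS₁, hS₂, Finset.mem_product, Finset.mem_union, Finset.mem_filter] using hks
    -- both frames are above the shell at `((i,kv),σ)`
    have hsq : ∀ {x : ℝ}, Λ ≤ |x| → Λ ^ 2 ≤ x ^ 2 := fun {x} h1 => by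
      calc Λ ^ 2 ≤ |x| ^ 2 := by gcongr
        _ = x ^ 2 := sq_abs _
    refine mismatchDefect_eq_zero_of_ge hβ μ K₁ K₂ Λ hΛ i kv σ ?_ ?_
    · by_cases hω : |matsubaraFreq β M i| < Λ
      · exact (hsq (hks'.2 hω)).trans (le_add_of_nonneg_left (sq_nonneg _))
      · exact (hsq (not_lt.1 hω)).trans (le_add_of_nonneg_right (sq_nonneg _))
    · by_cases hω : |matsubaraFreq β M i| < Λ
      · exact (hsq (hks'.1 hω)).trans (le_add_of_nonneg_left (sq_nonneg _))
      · exact (hsq (not_lt.1 hω)).trans (le_add_of_nonneg_right (sq_nonneg _))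
  -- restrict the sum to the support and bound each term by `c`
  have hsum : ∑ ks : FreqMomentum L M × Fin 2,
      ‖uvSymbolCT L M β μ K₂ Λ ks /
            (1 + uvSymbolCT L M β μ K₂ Λ ks * (((fsub K₂ K₁).eval (latticeMomentum L ks.1.2) / (β * (L : ℝ) ^ 2) : ℝ) : ℂ)) -
          uvSymbolCT L M β μ K₁ Λ ks‖ =
      ∑ ks ∈ Supp, ‖uvSymbolCT L M β μ K₂ Λ ks /
            (1 + uvSymbolCT L M β μ K₂ Λ ks * (((fsub K₂ K₁).eval (latticeMomentum L ks.1.2) / (β * (L : ℝ) ^ 2) : ℝ) : ℂ)) -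
          uvSymbolCT L M β μ K₁ Λ ks‖ := by
    rw [← Finset.sum_subset (Finset.subset_univ Supp)]
    intro ks _ hks
    rw [hzero ks hks, norm_zero]
  rw [hsum]
  have hterm : ∀ ks ∈ Supp, ‖uvSymbolCT L M β μ K₂ Λ ks /
            (1 + uvSymbolCT L M β μ K₂ Λ ks * (((fsub K₂ K₁).eval (latticeMomentum L ks.1.2) / (β * (L : ℝ) ^ 2) : ℝ) : ℂ)) -
          uvSymbolCT L M β μ K₁ Λ ks‖ ≤ c := by
    rintro ⟨⟨i, kv⟩, σ⟩ _
    refine (norm_mismatchDefect_le hβ μ K₁ K₂ Λ hB0 hB hΛ i kv σ ((hD kv).trans ht)).trans ?_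
    exact mul_le_mul_of_nonneg_left (hD kv) (by positivity)
  refine (Finset.sum_le_card_nsmul Supp _ c hterm).trans ?_
  rw [nsmul_eq_mul]
  refine mul_le_mul_of_nonneg_right ?_ hc
  -- the count
  have hcard : (Supp.card : ℝ) ≤ 2 * (Nω : ℝ) * ((N₁ : ℝ) + N₂) := by
    have h1 : Supp.card = Sω.card * (S₁ ∪ S₂).card * 2 := by
      rw [hSupp, Finset.card_product, Finset.card_product, Finset.card_univ, Fintype.card_fin]
    have h2 : (S₁ ∪ S₂).card ≤ N₁ + N₂ := (Finset.card_union_le _ _).trans (add_le_add hN₁ hN₂)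
    have h3 : (Supp.card : ℝ) = (Sω.card : ℝ) * ((S₁ ∪ S₂).card : ℝ) * 2 := by rw [h1]; push_cast; ring
    rw [h3]
    have hω' : (Sω.card : ℝ) ≤ Nω := by exact_mod_cast hNω
    have h2' : ((S₁ ∪ S₂).card : ℝ) ≤ (N₁ : ℝ) + N₂ := by exact_mod_cast h2
    nlinarith [Nat.cast_nonneg (α := ℝ) Sω.card, Nat.cast_nonneg (α := ℝ) (S₁ ∪ S₂).card]
  exact hcard

end Shell

/-! ## §2 COMPOSED: the frame difference of the scale-`n` self-energies minus the mismatch is ONE covariance response -/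

section Composed

variable {β : ℝ} (hβ : 0 < β) (U μ : ℝ) (K₁ K₂ : TrigPolyC4v) (e₀ : ℝ) (n : ℕ)
include hβ

/-- **`‖Σ[T(K₂)] − Σ[T(K₁)] − D(p_k⃗)‖ ≤ 2|β|L²·12·(Σ_ks‖d(ks)‖)·N` AT A READING POINT BELOW BOTH SHELLS** (`ω_i² + e_{K_j}(k⃗)² ≤ Λ_n²/4`), for the scale-`n`
one-shot actions of ONE volume/cutoff at two frames, `d = Ψ̃ − Ψ_{K₁}`: p549694's exact reading form + the door of §2 along `C_t = normalCovariance (Ψ_{K₁} + t·d)`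
with the vertex `V_U + 𝒩_{K₁}` (`Z_t ≠ 0`, four-leg sup `N`, two-leg sup `S` — whose term drops since `d(k,σ) = 0` there; frame-`K₂` partition function nonzero).
[cite: FeldmanSalmhoferTrubowitz1996, §1] -/
theorem norm_klSelfEnergy_frame_sub_sub_mismatch_le
    (hZ₂ : effPartitionFn ℂ (normalCovariance L M (uvSymbolCT L M β μ K₂ (klScale e₀ n)))
      (hubbardInteraction L M β U + counterQuadratic L M β K₂) ≠ 0)
    (i : MatsubaraIdx M) (kv : TorusSite 2 L) (σ : Fin 2) (hΛ : 0 < klScale e₀ n)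
    (h₂ : matsubaraFreq β M i ^ 2 + nambuXiCT L μ K₂ kv ^ 2 ≤ klScale e₀ n ^ 2 / 4)
    (h₁ : matsubaraFreq β M i ^ 2 + nambuXiCT L μ K₁ kv ^ 2 ≤ klScale e₀ n ^ 2 / 4)
    (hZ : ∀ t ∈ Set.Icc (0 : ℝ) 1, effPartitionFn ℂ
      (normalCovariance L M (uvSymbolCT L M β μ K₁ (klScale e₀ n)) + ((t : ℂ)) •
        (normalCovariance L M (fun ks => uvSymbolCT L M β μ K₂ (klScale e₀ n) ks /
            (1 + uvSymbolCT L M β μ K₂ (klScale e₀ n) ks * (((fsub K₂ K₁).eval (latticeMomentum L ks.1.2) / (β * (L : ℝ) ^ 2) : ℝ) : ℂ))) -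
          normalCovariance L M (uvSymbolCT L M β μ K₁ (klScale e₀ n))))
      (hubbardInteraction L M β U + counterQuadratic L M β K₁) ≠ 0)
    {N S : ℝ}
    (hN : ∀ t ∈ Set.Icc (0 : ℝ) 1, ∀ A : HubbardFieldIdx L M,
      ‖kernel ℂ (effAction ℂ (normalCovariance L M (uvSymbolCT L M β μ K₁ (klScale e₀ n)) + ((t : ℂ)) •
        (normalCovariance L M (fun ks => uvSymbolCT L M β μ K₂ (klScale e₀ n) ks /
            (1 + uvSymbolCT L M β μ K₂ (klScale e₀ n) ks * (((fsub K₂ K₁).eval (latticeMomentum L ks.1.2) / (β * (L : ℝ) ^ 2) : ℝ) : ℂ))) -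
          normalCovariance L M (uvSymbolCT L M β μ K₁ (klScale e₀ n))))
        (hubbardInteraction L M β U + counterQuadratic L M β K₁)) 4
        (Fin.snoc (Fin.snoc ![((((i, kv), σ), 0) : HubbardFieldIdx L M), (((i, kv), σ), 1)] ((A.1, 1 - A.2)) : Fin 3 → HubbardFieldIdx L M) A)‖ ≤ N)
    (hS : ∀ t ∈ Set.Icc (0 : ℝ) 1,
      ‖kernel ℂ (effAction ℂ (normalCovariance L M (uvSymbolCT L M β μ K₁ (klScale e₀ n)) + ((t : ℂ)) •
        (normalCovariance L M (fun ks => uvSymbolCT L M β μ K₂ (klScale e₀ n) ks /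
            (1 + uvSymbolCT L M β μ K₂ (klScale e₀ n) ks * (((fsub K₂ K₁).eval (latticeMomentum L ks.1.2) / (β * (L : ℝ) ^ 2) : ℝ) : ℂ))) -
          normalCovariance L M (uvSymbolCT L M β μ K₁ (klScale e₀ n))))
        (hubbardInteraction L M β U + counterQuadratic L M β K₁)) 2 ![((((i, kv), σ), 0) : HubbardFieldIdx L M), (((i, kv), σ), 1)]‖ ≤ S) :
    ‖klSelfEnergy L M β U μ K₂ e₀ n (i, kv) σ - klSelfEnergy L M β U μ K₁ e₀ n (i, kv) σ -
        ((fsub K₂ K₁).eval (latticeMomentum L kv) : ℂ)‖ ≤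
      2 * (|β| * (L : ℝ) ^ 2) * (12 * (∑ ks : FreqMomentum L M × Fin 2,
        ‖uvSymbolCT L M β μ K₂ (klScale e₀ n) ks /
              (1 + uvSymbolCT L M β μ K₂ (klScale e₀ n) ks * (((fsub K₂ K₁).eval (latticeMomentum L ks.1.2) / (β * (L : ℝ) ^ 2) : ℝ) : ℂ)) -
            uvSymbolCT L M β μ K₁ (klScale e₀ n) ks‖) * N) := by
  have hL : (0 : ℝ) < L := by exact_mod_cast NeZero.pos L
  -- the partition functions at the two frames
  have hZ₁ : IsUnit (effPartitionFn ℂ (normalCovariance L M (uvSymbolCT L M β μ K₁ (klScale e₀ n)))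
      (hubbardInteraction L M β U + counterQuadratic L M β K₁)) := by
    have h0 := hZ 0 ⟨le_rfl, zero_le_one⟩
    rw [Complex.ofReal_zero, zero_smul, add_zero] at h0
    exact isUnit_iff_ne_zero.2 h0
  have hZ₂' : IsUnit (effPartitionFn ℂ (normalCovariance L M (uvSymbolCT L M β μ K₂ (klScale e₀ n)))
      (hubbardInteraction L M β U + counterQuadratic L M β K₂)) := isUnit_iff_ne_zero.2 hZ₂
  -- the reading point is below the `K₂`-shell: `Ψ_{K₂}((i,kv),σ) = 0`, and the defect vanishes there
  have hk : uvSymbolCT L M β μ K₂ (klScale e₀ n) ((i, kv), σ) = 0 := by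
    rw [uvSymbolCT_eq_uvSymbolFn hβ, uvSymbolFn, uvWeightFn_eq_zero_of_le hΛ h₂]
    simp
  have hd : uvSymbolCT L M β μ K₂ (klScale e₀ n) ((i, kv), σ) /
          (1 + uvSymbolCT L M β μ K₂ (klScale e₀ n) ((i, kv), σ) *
            (((fsub K₂ K₁).eval (latticeMomentum L kv) / (β * (L : ℝ) ^ 2) : ℝ) : ℂ)) -
        uvSymbolCT L M β μ K₁ (klScale e₀ n) ((i, kv), σ) = 0 :=
    mismatchDefect_eq_zero_of_le hβ μ K₁ K₂ (klScale e₀ n) hΛ i kv σ h₂ h₁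
  -- p549694's exact reading form, with the semigroup step undone
  have hexact := klSelfEnergy_frame_sub_eq_mismatch_add_response hβ U μ K₁ K₂ e₀ n hZ₂' hZ₁ (i, kv) σ hk
  have hresp := covRespCT_norm_selfEnergy_sub_le β U K₁ (uvSymbolCT L M β μ K₁ (klScale e₀ n))
    (fun ks => uvSymbolCT L M β μ K₂ (klScale e₀ n) ks /
      (1 + uvSymbolCT L M β μ K₂ (klScale e₀ n) ks * (((fsub K₂ K₁).eval (latticeMomentum L ks.1.2) / (β * (L : ℝ) ^ 2) : ℝ) : ℂ)))
    (i, kv) σ hZ hN hS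
  rw [hexact, add_sub_cancel_left, ← effAction_mismatchResummed_eq_effAction_defect_klEffectiveAction U μ K₁ K₂ e₀ n hZ₁,
    klSelfEnergy_eq_selfEnergy_normalCovariance β U μ K₁ e₀ n]
  refine hresp.trans (le_of_eq ?_)
  simp only [hd, norm_zero, mul_zero, zero_mul, add_zero]

end Composed

end Summit.HubbardSuperconductivity.HubbardSuperconductivity.Theorems.TwoVolumeDefect

end
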